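import Literature.NumberTheory.EllipticCurves.SelmerPInftyRelModelAction
import Literature.NumberTheory.EllipticCurves.IwasawaSelmerControl
import Literature.NumberTheory.EllipticCurves.BSDSelmerParityDokchitserHeegnerFieldProofs
import Literature.NumberTheory.EllipticCurves.DiscreteH1Equiv
import Summits.BirchSwinnertonDyer.Rank1Residual.Additive.ZpTowerSeam
import HarnessLib

/-!
# T-E3g-BUDn-K (iii, first half): `H¹(K_{n,∞}, E_{K_n}[p^∞]) ≃ H¹(K_∞, E[p^∞])` — the kernel of the
# restricted tower and the original tower have isomorphic cohomology (the `modelIso` pattern one level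
# up; r2 ROUTE-2 §II.17.7 T-res, group/coefficient half) (cell `b2b-bsdres`, n1011, p01 GEN 2)

HONEST FRAMING (cell `b2b-bsdres`, verbatim in every file): prove what is provable now; nothing is
booked; no label changes. Infrastructure; DEFINITIONS (three maps) + THEOREMS; NO Literature fact;
no `sorry`. This is the FIRST HALF of r2's transport lemma T-res
(`(W.baseChange K_n).selmerInfty κ_n ↪ W.selmerInfty κ`): the continuous isomorphism
`ker κ_n ≃ ker κ` (`σ ↦ σ|_{K̄}`, inverse through `rangeToResGal K_n` — `ker κ ≤ galRange K_n` by the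
seam) and the coefficient isomorphism `E[p^∞](K̄) ≃ E_{K_n}[p^∞](K̄_{K_n})`
(`primaryBaseChangeEquiv`) form mutually inverse compatible pairs, whence an additive isomorphism
`kerH1Iso : H¹(ker κ_n, E_{K_n}[p^∞]) ≃+ H¹(ker κ, E[p^∞])` (verbatim the argument of the tree's
`modelIso`, with `Γ_L ⇄ galRange L` replaced by `ker κ_n ⇄ ker κ`). The SECOND HALF — that
`kerH1Iso` carries the Selmer conditions over `K_n` (places `w` of `K_n`, conjugates under `Γ_{K_n}`)
into those over `K` (places `v` of `K`, conjugates under `Γ_K`) — is NOT in this file.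

References: [SerreGaloisCohomology1997] I.§2.4, II.§1.1; [Washington1997] §13.1.
-/

noncomputable section

open scoped Classical

open Literature.NumberTheory.EllipticCurves

universe u

namespace Summit.BirchSwinnertonDyer.Rank1Residual.Additive.ZpTower

variable {K : Type u} [Field K] [NumberField K] {p : ℕ} [Fact p.Prime]

section KernelIso

variable (W : WeierstrassCurve K) (κ : ZpExtension K p) (n : ℕ) (κn : ZpExtension (κ.layer n) p)
  (hκn : ∀ σ : Field.absoluteGaloisGroup (κ.layer n),
    (κn σ).toAdd * (p : ℤ_[p]) ^ n = (κ (resGal (K := K) (κ.layer n) σ)).toAdd)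

/-- `ker κ ≤ galRange K_n` (`ker κ ≤ κ⁻¹(pⁿℤ_p) = galRange K_n`, the seam). [cite: Washington1997, §13.1] -/
theorem kerSubgroup_le_galRange_layer : κ.kerSubgroup ≤ galRange (K := K) (κ.layer n) := by
  rw [galRange_layer_eq_layerSubgroup κ n]
  exact κ.kerSubgroup_le_layerSubgroup n

/-- The continuous homomorphism `ker κ → Γ_{K_n}`, `τ ↦ (resGal K_n|^{galRange})⁻¹ τ`
(`rangeToResGal K_n` on `ker κ ≤ galRange K_n`). [cite: SerreGaloisCohomology1997, II.§1.1] -/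
def kerToGal : κ.kerSubgroup →ₜ* Field.absoluteGaloisGroup (κ.layer n) where
  toFun τ := rangeToResGal (K := K) (κ.layer n) ⟨τ, kerSubgroup_le_galRange_layer κ n τ.2⟩
  map_one' := by
    rw [show (⟨((1 : κ.kerSubgroup) : Field.absoluteGaloisGroup K),
        kerSubgroup_le_galRange_layer κ n (1 : κ.kerSubgroup).2⟩ :
          galRange (K := K) (κ.layer n)) = 1 from rfl, map_one]
  map_mul' σ τ := by
    rw [show (⟨((σ * τ : κ.kerSubgroup) : Field.absoluteGaloisGroup K),
        kerSubgroup_le_galRange_layer κ n (σ * τ : κ.kerSubgroup).2⟩ :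
          galRange (K := K) (κ.layer n)) =
        ⟨σ, kerSubgroup_le_galRange_layer κ n σ.2⟩ * ⟨τ, kerSubgroup_le_galRange_layer κ n τ.2⟩
        from rfl, map_mul]
  continuous_toFun :=
    (rangeToResGal (K := K) (κ.layer n)).continuous_toFun.comp
      (continuous_subtype_val.subtype_mk _)

/-- Unfolding `kerToGal`. [folklore] -/
theorem kerToGal_apply (τ : κ.kerSubgroup) :
    kerToGal κ n τ =
      rangeToResGal (K := K) (κ.layer n) ⟨τ, kerSubgroup_le_galRange_layer κ n τ.2⟩ :=
  rfl

/-- `resGal (kerToGal τ) = τ`. [folklore] -/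
@[simp]
theorem resGal_kerToGal (τ : κ.kerSubgroup) :
    resGal (K := K) (κ.layer n) (kerToGal κ n τ) = τ := by
  rw [kerToGal_apply, resGal_rangeToResGal]

include hκn

/-- **`ker κ_n → ker κ`, `σ ↦ σ|_{K̄}`** (`resGal K_n` restricted–corestricted; well defined by
`ker κ_n = resGal⁻¹(ker κ)`), a continuous monoid homomorphism. [cite: SerreGaloisCohomology1997, II.§1.1] -/
def kerToKer : κn.kerSubgroup →ₜ* κ.kerSubgroup where
  toFun σ := ⟨resGal (K := K) (κ.layer n) σ,
    (mem_kerSubgroup_restrictTower_iff κ n κn hκn σ).mp σ.2⟩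
  map_one' := Subtype.ext (map_one _)
  map_mul' _ _ := Subtype.ext (map_mul _ _ _)
  continuous_toFun :=
    ((resGal (K := K) (κ.layer n)).continuous_toFun.comp continuous_subtype_val).subtype_mk _

omit [NumberField K] in
/-- Values of `kerToKer`. [folklore] -/
@[simp]
theorem coe_kerToKer (σ : κn.kerSubgroup) :
    ((kerToKer κ n κn hκn σ : κ.kerSubgroup) : Field.absoluteGaloisGroup K) =
      resGal (K := K) (κ.layer n) σ :=
  rfl

/-- `kerToGal` lands in `ker κ_n` (`ker κ_n = resGal⁻¹(ker κ)`). [folklore] -/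
theorem kerToGal_mem (τ : κ.kerSubgroup) : kerToGal κ n τ ∈ κn.kerSubgroup := by
  rw [mem_kerSubgroup_restrictTower_iff κ n κn hκn, resGal_kerToGal]
  exact τ.2

/-- **`ker κ → ker κ_n`, `τ ↦ (resGal K_n)⁻¹ τ`** (through `rangeToResGal K_n` on
`ker κ ≤ galRange K_n`), a continuous monoid homomorphism. [cite: SerreGaloisCohomology1997, II.§1.1] -/
def kerOfKer : κ.kerSubgroup →ₜ* κn.kerSubgroup where
  toFun τ := ⟨kerToGal κ n τ, kerToGal_mem κ n κn hκn τ⟩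
  map_one' := Subtype.ext (map_one (kerToGal κ n))
  map_mul' σ τ := Subtype.ext (map_mul (kerToGal κ n) σ τ)
  continuous_toFun := (kerToGal κ n).continuous_toFun.subtype_mk _

/-- Values of `kerOfKer` in `Γ_K`: `resGal (kerOfKer τ) = τ`. [folklore] -/
@[simp]
theorem resGal_kerOfKer (τ : κ.kerSubgroup) :
    resGal (K := K) (κ.layer n) (kerOfKer κ n κn hκn τ : κn.kerSubgroup) = τ :=
  resGal_kerToGal κ n τ

/-- `kerToKer ∘ kerOfKer = id`. [folklore] -/
@[simp]
theorem kerToKer_kerOfKer (τ : κ.kerSubgroup) :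
    kerToKer κ n κn hκn (kerOfKer κ n κn hκn τ) = τ :=
  Subtype.ext (resGal_kerOfKer κ n κn hκn τ)

/-- `kerOfKer ∘ kerToKer = id` (`resGal K_n` is injective). [folklore] -/
@[simp]
theorem kerOfKer_kerToKer (σ : κn.kerSubgroup) :
    kerOfKer κ n κn hκn (kerToKer κ n κn hκn σ) = σ := by
  apply Subtype.ext
  apply resGal_injective (K := K) (κ.layer n)
  rw [resGal_kerOfKer]
  rfl

omit [NumberField K] in
/-- Compatibility of the pair `(kerToKer, primaryBaseChangeEquiv)`. [folklore] -/
theorem primaryBaseChangeEquiv_kerToKer_smul (σ : κn.kerSubgroup) (P : W.geomPrimaryTorsion p) :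
    primaryBaseChangeEquiv (κ.layer n) W p (kerToKer κ n κn hκn σ • P) =
      σ • primaryBaseChangeEquiv (κ.layer n) W p P := by
  rw [Subgroup.smul_def, Subgroup.smul_def, coe_kerToKer,
    ← primaryBaseChangeEquiv_smul (κ.layer n) W p (σ : Field.absoluteGaloisGroup (κ.layer n)) P,
    Subgroup.smul_def, coe_resGalToRange]

/-- Compatibility of the pair `(kerOfKer, primaryBaseChangeEquiv⁻¹)`. [folklore] -/
theorem primaryBaseChangeEquiv_symm_kerOfKer_smul (τ : κ.kerSubgroup)
    (Q : (W.baseChange (κ.layer n)).geomPrimaryTorsion p) :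
    (primaryBaseChangeEquiv (κ.layer n) W p).symm (kerOfKer κ n κn hκn τ • Q) =
      τ • (primaryBaseChangeEquiv (κ.layer n) W p).symm Q := by
  rw [Subgroup.smul_def, Subgroup.smul_def]
  have h := primaryBaseChangeEquiv_symm_smul (κ.layer n) W p
    ⟨τ, kerSubgroup_le_galRange_layer κ n τ.2⟩ Q
  rw [Subgroup.smul_def] at h
  exact h

/-- **`H¹(ker κ_n, E_{K_n}[p^∞]) ≃ H¹(ker κ, E[p^∞])`**: the maps of the mutually inverse compatible
pairs `(kerOfKer, primaryBaseChangeEquiv⁻¹)` and `(kerToKer, primaryBaseChangeEquiv)` — the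
cohomology over the top of the restricted tower `K_{n,∞} = K_∞` in the two subgroup models.
[cite: SerreGaloisCohomology1997, I.§2.4] -/
def kerH1Iso :
    (W.baseChange (κ.layer n)).subgroupH1 p κn.kerSubgroup ≃+ W.subgroupH1 p κ.kerSubgroup where
  toFun := resH1Hom (kerOfKer κ n κn hκn)
    (primaryBaseChangeEquiv (κ.layer n) W p).symm.toAddMonoidHom
    (primaryBaseChangeEquiv_symm_kerOfKer_smul W κ n κn hκn)
  invFun := resH1Hom (kerToKer κ n κn hκn)
    (primaryBaseChangeEquiv (κ.layer n) W p).toAddMonoidHom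
    (primaryBaseChangeEquiv_kerToKer_smul W κ n κn hκn)
  left_inv x := by
    rw [resH1Hom_resH1Hom]
    have e : resH1Hom ((kerOfKer κ n κn hκn).comp (kerToKer κ n κn hκn))
        ((primaryBaseChangeEquiv (κ.layer n) W p).toAddMonoidHom.comp
          (primaryBaseChangeEquiv (κ.layer n) W p).symm.toAddMonoidHom)
        (fun x m ↦ by
          simp only [AddMonoidHom.coe_comp, Function.comp_apply, AddEquiv.coe_toAddMonoidHom,
            ContinuousMonoidHom.comp_toFun, primaryBaseChangeEquiv_symm_kerOfKer_smul,
            primaryBaseChangeEquiv_kerToKer_smul]) =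
          resH1Hom (ContinuousMonoidHom.id _) (AddMonoidHom.id _) (fun _ _ ↦ rfl) :=
      resH1Hom_congr (ContinuousMonoidHom.ext fun σ ↦ kerOfKer_kerToKer κ n κn hκn σ)
        (AddMonoidHom.ext fun Q ↦ (primaryBaseChangeEquiv (κ.layer n) W p).apply_symm_apply Q) _ _
    rw [e, resH1Hom_id]
    rfl
  right_inv x := by
    rw [resH1Hom_resH1Hom]
    have e : resH1Hom ((kerToKer κ n κn hκn).comp (kerOfKer κ n κn hκn))
        ((primaryBaseChangeEquiv (κ.layer n) W p).symm.toAddMonoidHom.comp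
          (primaryBaseChangeEquiv (κ.layer n) W p).toAddMonoidHom)
        (fun x m ↦ by
          simp only [AddMonoidHom.coe_comp, Function.comp_apply, AddEquiv.coe_toAddMonoidHom,
            ContinuousMonoidHom.comp_toFun, primaryBaseChangeEquiv_symm_kerOfKer_smul,
            primaryBaseChangeEquiv_kerToKer_smul]) =
          resH1Hom (ContinuousMonoidHom.id _) (AddMonoidHom.id _) (fun _ _ ↦ rfl) :=
      resH1Hom_congr (ContinuousMonoidHom.ext fun τ ↦ kerToKer_kerOfKer κ n κn hκn τ)
        (AddMonoidHom.ext fun P ↦ (primaryBaseChangeEquiv (κ.layer n) W p).symm_apply_apply P) _ _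
    rw [e, resH1Hom_id]
    rfl
  map_add' := map_add _

/-- `kerH1Iso` as a function: the map of the pair `(kerOfKer, primaryBaseChangeEquiv⁻¹)`. [folklore] -/
theorem kerH1Iso_apply (x : (W.baseChange (κ.layer n)).subgroupH1 p κn.kerSubgroup) :
    kerH1Iso W κ n κn hκn x = resH1Hom (kerOfKer κ n κn hκn)
      (primaryBaseChangeEquiv (κ.layer n) W p).symm.toAddMonoidHom
      (primaryBaseChangeEquiv_symm_kerOfKer_smul W κ n κn hκn) x :=
  rfl

/-- `kerH1Iso⁻¹` as a function: the map of the pair `(kerToKer, primaryBaseChangeEquiv)`. [folklore] -/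
theorem kerH1Iso_symm_apply (y : W.subgroupH1 p κ.kerSubgroup) :
    (kerH1Iso W κ n κn hκn).symm y = resH1Hom (kerToKer κ n κn hκn)
      (primaryBaseChangeEquiv (κ.layer n) W p).toAddMonoidHom
      (primaryBaseChangeEquiv_kerToKer_smul W κ n κn hκn) y :=
  rfl

/-- In particular an INJECTIVE additive map `H¹(ker κ_n, E_{K_n}[p^∞]) → H¹(ker κ, E[p^∞])`
exists (what T-res needs on the ambient groups). [folklore] -/
theorem kerH1Iso_injective : Function.Injective (kerH1Iso W κ n κn hκn) :=
  (kerH1Iso W κ n κn hκn).injective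

end KernelIso

end Summit.BirchSwinnertonDyer.Rank1Residual.Additive.ZpTower

end
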